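/-
COR-CM (cells pub-hodgecm / pub-hodgecm2, stage 2 of the Hodge ladder) — TRANSPOSITION SURGE, item (vi) sub-binder S2 / (vi-2)
`supply`: the PINNED as-printed junction RE-TYPED (coordinator ruling 2026-08-21T18:44:30Z (1): «clause (β) RE-TYPED to the
consumed form + the hirr D6.3 nit repaired TONIGHT (own-htheta / tr-typer-3 with a kernel witness)»).  Seat
prover-pub-hodgecm-own-htheta-g3-0 (own-htheta gen 3, owner of the item-(vi) lineage; rule-(1) path claim pub-hodgecm2/INBOX
2026-08-21T18:51:23Z).  NEW file, theorems only: no definition, no instance, no named fact, nothing asserted, no proof holes.  The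
LANDED junction `Transposition/Item6SupplyPinned.lean` (p297535) and every other tree file are untouched (append = new file importing
them); decl names carry the suffixes `_def411` / `_meeting_rec`.  FRAMING: HC_CM is NOT proved.

TWO REPAIRS, both of typing, neither a new mathematical input:
(R1) red-team (A) AUDIT-CITESCOPE DELTA 6, D6.3 (hodge-director/AUDIT-CITESCOPE.md :323): the landed binder `hirr`
     (`((D F ι₁ V Φ).rhoAt i).IsIrreducible`, Mathlib = `IsSimpleOrder (Subrepresentation _)`) CARRIES `ω(μ,ε,χ) ≠ 0`, which
     [Liu2021] Def. 4.11 as printed does NOT assert (Liu's «irreducible» allows the zero space, App. D Lem. D.1 l. 5226–5229; the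
     tree's record `Liu2021.Def411AsPrinted`, READING I1, types it that way).  REPAIR (D6.3's binder-shape option, token for token):
     `hChi` + `hirr` + `hsm` ↦ `h411 : Def411AsPrinted (D F ι₁ V Φ)` (the as-printed RECORD, p295530) +
     `hnv : ∃ i, Nontrivial ((D F ι₁ V Φ).omegaAt i)` («SOME μ-admissible ω(μ,ε,χ) is a non-zero space» — [Liu2021] App. D
     Lem. D.1 (1) l. 5226–5229 «ω(μ,ε,χ) is zero if and only if E is a field, V is anisotropic (in particular n = 2), and χ̌ = μ²»
     at n = 3, every local factor non-zero, with Def. 4.12 / weak approximation for the existence of a μ-admissible pair; the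
     LOCAL record is `Literature.RepresentationTheory.Liu2021.LocalOscillatorDatum.IrreducibleAdmissible`, the LOCAL→GLOBAL ⊗′ step
     is item6-p3's announced `AdelicOscillatorNonvanishing.lean`, which will discharge `hnv` BY NAME — not a dependency here).
     Kernel: item6-p3's `Thm418Data.exists_homK_ne_zero_of_def411` (`Liu2021/Thm418InvariantsAsPrinted.lean`, p298169).
     ALSO the Galois guard of `hCM` is aligned to the explicit shape of the other binders (review note 3 on p297535).
(R2) red-team (C) STATUS-2100 §6 (i) RULING OF RECORD (tgtbt-1 g6, hodge-director/INBOX l.808; countersigned cite-2 l.825; inputs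
     own-b01 l.785, x1 l.788, x2 l.791, b28 l.786): clause (β) `emb Γ' (cover^* x) = emb Γ x` of the dictionary binder `hD` in the
     END-DISPLAY lane (`Model.hc_cm_of_supply_of_dictionary_of_eq`, `Transposition/Item6HoldsRec.lean`:205/:221, fed by p297535's
     `Model.hc_cm_of_thm418AsPrinted_pinned`) is STRONGER THAN CONSUMED and false in prose for the tree's `Model.embOf`.  REPAIR: the
     END DISPLAYS below are cut in the CONSUMED form (g) of own-b01 l.785 — B01-S `U.FaceSupply` (what the pinned junctions
     conclude) composed BY NAME with x2's SPLIT meeting-form display `Model.hc_cm_of_supply_of_settingMeetSat_embOf_rec`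
     (`CorCM/B01/FaceWedgeOverlapBypassMeeting.lean`:297, p295997 ✔): the theta-side binder `hM` over `Model.embOf` — NO `HG`/`emb`/
     `cover` data, NO clause (α)/(β)/(γ); item (iii) enters through the tree theorems `Model.embOf_inner_emb` /
     `Model.embOf_ne_zero_of_two_lt`, the leaf B01-H through `heckeWedge10_of_heckeFamily`.  `hM`'s own residual ((E): C5′ at
     SATURATED sets; (v-S), C6′) is spelled out in that file's header and is own-b01's / the x-lanes' business, not S2's.

CONSISTENCY / STRENGTH: (R1)'s binder family is inhabited on `U_rec` iff B01-S holds there — «⇐»: at the toy datum of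
`Item6SupplyPinnedCertificate.lean` (ω := ℂ trivial action: irreducible-or-zero, smooth, admissible ⇒ `Def411AsPrinted`; `hnv` at the
one index) — the in-kernel certificate rides with that file's v-next; T5 derive-False line by pub-hodgecm2-t5-consist-1 on these exact
bytes is quoted in the filing note.  HC_CM is NOT proved; `hCM`, `hReach`, `hM` are inhabited by no one.
-/
import Summits.HodgeConjecture.CorCM.B01.Transposition.Item6SupplyPinned
import Summits.HodgeConjecture.CorCM.B01.FaceWedgeOverlapBypassMeeting
import Literature.NumberTheory.Automorphic.Liu2021.Thm418InvariantsAsPrinted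
import HarnessLib

/-!
# Item (vi) S2 at a PINNED datum, RE-TYPED: Def. 4.11 AS PRINTED + Lem. D.1 (1) in place of `hirr`; (β)-free END DISPLAYS

Namespace `Summit.HodgeConjecture.CorCM.Model`; `U = picardCMUniverse hHD hI h₁ h₃` in §1, the universe OF RECORD in §2.

* §1 `faceSupply_of_thm418AsPrinted_pinned_def411` — B01-S `U.FaceSupply` from: the cite binder `hLiu` ([Liu2021] Thm. 4.18
  EXACTLY as printed, `Liu2021.Thm418AsPrinted`), `hObj` (Prop. 4.6 (1) «𝒜(μ) is nonempty», conjunct one of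
  `Liu2021.Prop46_1AsPrinted`), `h411` ([Liu2021] Def. 4.11 EXACTLY as printed, the RECORD `Liu2021.Def411AsPrinted`), `hnv`
  (App. D Lem. D.1 (1) at n = 3 with Def. 4.12: some μ-admissible `ω(μ,ε,χ)` is a non-zero space), the CHOICE `hμ`
  (`Φ_μ = Φ^{*ι₁}`), and the PIN `Aμ` with `hCM` (Def. 4.5 (1)–(2) + Def. 4.3 (2) at the dictionary, binder-1's `reflexCMType`) and
  `hReach` (§4.2 + App. C Prop. C.5 read with the non-Liu inputs (h2)–(h4) of `Item6SupplyPinned.lean`'s docstring = the S2-CRUX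
  (M-Sh)) — every binder GUARDED to Galois CM `F`, `6 ≤ [F:ℚ]`, `Φ ∋ ι₁`; + `exists_supplyWitness_of_thm418AsPrinted_pinned_def411`
  (the ∃ι₁∃V∃Γ form).
* §2 END DISPLAYS on the universe OF RECORD, (β)-FREE, in the consumed form (g):
  `hc_cm_of_thm418AsPrinted_pinned_meeting_rec` — p297535's EIGHT binders VERBATIM + `hM`;
  `hc_cm_of_thm418AsPrinted_pinned_def411_meeting_rec` — §1's re-typed binders + `hM`.
What stays undischarged is unchanged in content (hodge-director/ITEM6-SPLIT.md §5): `hμ` is a choice; `hLiu`/`hObj`/`h411` are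
as-printed records by name; `hnv` is Lem. D.1 (1) (item6-p3's ⊗′ file discharges it); `hCM` → pin-2 (`Item6PinMatch.lean`) / binder-1;
`hReach` → pin-1 (`Item6PinReach.lean`: `hComp`, `homE`/`hE`); `hM` → own-b01.  HC_CM is NOT proved.
-/

noncomputable section

open scoped TensorProduct InnerProductSpace

namespace Summit.HodgeConjecture.CorCM.Model

open CategoryTheory AlgebraicGeometry NumberField
open MeasureTheory (Lp)
open Literature.AlgebraicGeometry.Motives
open Literature.AlgebraicGeometry.Motives.HodgeStructure (conj)
open Literature.AlgebraicGeometry.HodgeTheory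
open Literature.AlgebraicGeometry.ComplexMultiplication (IsCMTypeRealisation)
open Literature.NumberTheory.ComplexMultiplication
open Literature.NumberTheory.Automorphic
open Literature.NumberTheory.Automorphic.PicardCM
open Literature.NumberTheory.Automorphic.Liu2021
open Prior.Perl34File (Perl34.IsolationSetting)
open Prior.Perl34File.Perl34

/-! ## §1  S2 at a pinned datum with Def. 4.11 AS PRINTED + Lem. D.1 (1) (repair R1) -/

section Data

/-- **B01-S from [Liu 2021, Thm. 4.18] AS PRINTED at a PINNED datum, `hirr` RE-TYPED** (`U = picardCMUniverse hHD hI h₁ h₃`).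
As `Model.faceSupply_of_thm418AsPrinted_pinned` (p297535) with the binders `hChi`, `hirr`, `hsm` REPLACED by
* `h411` — [Liu2021] Def. 4.11 EXACTLY AS PRINTED for the consumer's datum: the tree RECORD `Liu2021.Def411AsPrinted (D F ι₁ V Φ)`
           (every `ω(μ,ε,χ)` irreducible-OR-ZERO, smooth, admissible — READINGS I1/I2 of `Liu2021/Def411AsPrinted.lean`; only the
           smoothness conjunct is used);
* `hnv`  — «some μ-admissible `ω(μ,ε,χ)` is a non-zero space»: [Liu2021] App. D Lem. D.1 (1) (`FJcycle.tex` l. 5226–5229: «ω(μ,ε,χ)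
           is zero if and only if E is a field, V is anisotropic (in particular n = 2), and χ̌ = μ²») at n = 3 — every local
           oscillator factor is non-zero, hence so is `⊗′_v` — together with Def. 4.12 (a μ-admissible pair `(ε, χ)` exists, weak
           approximation); degree- and face-uniform; the one input of this list that is not a tree record by name (item6-p3's
           `Thm418InvariantsAsPrinted.lean` module docstring says the same);
and `hCM`'s Galois guard written `(_ : IsGalois ℚ F)` explicitly like the other binders (review note 3 on p297535).  The remaining
binders `hLiu`, `hObj`, `hμ`, `hCM`, `hReach` and their sources are VERBATIM those of p297535 (docstring there).  KERNEL:
`Thm418Data.exists_homK_ne_zero_of_def411` (p298169: a non-zero `v ∈ ω_i` is fixed by an open `S` — smoothness from `h411` — and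
Thm. 4.18 (1)+(main) give `φ ≠ 0` in `Hom_K` at every open compact `K ≤ K₀`), intersected with `hReach`'s `Ksm`; then `hReach`,
`hCM`, binder-1's `exists_hom_cmAV_ne_zero_of_isInverse_reflex`, item6-p1's `faceSupply_of_albaneseFactor`.  No degree- or
face-specific input.  HC_CM is NOT proved; `hCM`/`hReach` are not inhabited here.
[cite: Liu2021, Thm. 4.18 (FJcycle.tex l. 2232–2245), Def. 4.11 (l. 2083–2097), App. D Lem. D.1 (1) (l. 5226–5229)] -/
theorem faceSupply_of_thm418AsPrinted_pinned_def411
    (hHD : exists_isReal_hodgeModel) (hI : hodgePQ_independent_of_hodgeModel)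
    (h₁ : BallQuotientUniformised) (h₃ : CMAbelianVarietyRealised)
    (D : ∀ (F : CMField) (ι₁ : F →+* ℂ) (_ : HermSpace3 F ι₁) (_ : CMType F), Thm418Data (maximalRealSubfield F) F)
    (Aμ : ∀ (F : CMField) (ι₁ : F →+* ℂ) (V : HermSpace3 F ι₁) (Φ : CMType F), (D F ι₁ V Φ).Obj → AbelianVariety ℂ)
    (hLiu : ∀ (F : CMField), IsGalois ℚ F → 6 ≤ Module.finrank ℚ F → ∀ (Φ : CMType F) (ι₁ : F →+* ℂ), ι₁ ∈ Φ.1 →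
      ∀ V : HermSpace3 F ι₁, Thm418AsPrinted (D F ι₁ V Φ))
    (hObj : ∀ (F : CMField), IsGalois ℚ F → 6 ≤ Module.finrank ℚ F → ∀ (Φ : CMType F) (ι₁ : F →+* ℂ), ι₁ ∈ Φ.1 →
      ∀ V : HermSpace3 F ι₁, Nonempty (D F ι₁ V Φ).Obj)
    (h411 : ∀ (F : CMField), IsGalois ℚ F → 6 ≤ Module.finrank ℚ F → ∀ (Φ : CMType F) (ι₁ : F →+* ℂ), ι₁ ∈ Φ.1 →
      ∀ V : HermSpace3 F ι₁, Def411AsPrinted (D F ι₁ V Φ))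
    (hnv : ∀ (F : CMField), IsGalois ℚ F → 6 ≤ Module.finrank ℚ F → ∀ (Φ : CMType F) (ι₁ : F →+* ℂ), ι₁ ∈ Φ.1 →
      ∀ V : HermSpace3 F ι₁, ∃ i : (D F ι₁ V Φ).AdmIndex, Nontrivial ((D F ι₁ V Φ).omegaAt i))
    (hμ : ∀ (F : CMField), IsGalois ℚ F → 6 ≤ Module.finrank ℚ F → ∀ (Φ : CMType F) (ι₁ : F →+* ℂ), ι₁ ∈ Φ.1 →
      ∀ (V : HermSpace3 F ι₁) (g : F ≃ₐ[ℚ] F),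
        ι₁.comp (g : F →+* F) ∈ (D F ι₁ V Φ).cmType.1 ↔ ι₁.comp (g.symm : F →+* F) ∈ Φ.1)
    (hCM : ∀ (F : CMField) (_ : IsGalois ℚ F), 6 ≤ Module.finrank ℚ F → ∀ (Φ : CMType F) (ι₁ : F →+* ℂ), ι₁ ∈ Φ.1 →
      ∀ (V : HermSpace3 F ι₁) (Dμ : (D F ι₁ V Φ).Obj),
        ∃ (M : Type) (_ : Field M) (_ : NumberField M) (_ : IsCMField M)
          (e : reflexField ℚ F (algValuedIn ι₁ (D F ι₁ V Φ).cmType.1) →+* M)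
          (ιB : 𝓞 M →+* End (Aμ F ι₁ V Φ Dμ)) (θB : M →+* Module.End ℂ (complexBetti (Aμ F ι₁ V Φ Dμ).X 1)),
          IsCMTypeRealisation (inducedCMType e (reflexCMType ι₁ (D F ι₁ V Φ).cmType (AlgHom.id ℚ F))) (Aμ F ι₁ V Φ Dμ) ιB θB)
    (hReach : ∀ (F : CMField), IsGalois ℚ F → 6 ≤ Module.finrank ℚ F → ∀ (Φ : CMType F) (ι₁ : F →+* ℂ), ι₁ ∈ Φ.1 →
      ∀ V : HermSpace3 F ι₁, ∃ Ksm : Subgroup (D F ι₁ V Φ).G, IsOpenCompact Ksm ∧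
        ∀ (K : Subgroup (D F ι₁ V Φ).G) (Dμ : (D F ι₁ V Φ).Obj) (φ : (D F ι₁ V Φ).HomK K Dμ),
          IsOpenCompact K → K ≤ Ksm → φ ≠ 0 →
            ∃ (Γ : Level V) (𝒥 : Jacobian (Var.scheme (ballQuotientUniformisedDatum_of h₁) h₃ (.pms (pmsCode F ι₁ V Γ))))
              (w : 𝒥.J ⟶ Aμ F ι₁ V Φ Dμ), w ≠ 0) :
    (picardCMUniverse hHD hI h₁ h₃).FaceSupply := by
  refine faceSupply_of_albaneseFactor hHD hI h₁ h₃ fun F hG h6 Φ ι₁ hι V => ?_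
  haveI := hG
  obtain ⟨Dμ⟩ := hObj F hG h6 Φ ι₁ hι V
  obtain ⟨i, hi⟩ := hnv F hG h6 Φ ι₁ hι V
  obtain ⟨Ksm, hKsm, hreach⟩ := hReach F hG h6 Φ ι₁ hι V
  obtain ⟨K₀, hK₀, hK⟩ := Thm418Data.exists_homK_ne_zero_of_def411 (hLiu F hG h6 Φ ι₁ hι V) (h411 F hG h6 Φ ι₁ hι V) Dμ i
  have hKK : IsOpenCompact (K₀ ⊓ Ksm) := by
    refine ⟨?_, ?_⟩ <;> rw [Subgroup.coe_inf]
    · exact hK₀.1.inter hKsm.1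
    · exact hK₀.2.inter_right (Subgroup.isClosed_of_isOpen Ksm hKsm.1)
  obtain ⟨φ, hφ⟩ := hK (K₀ ⊓ Ksm) hKK inf_le_left
  obtain ⟨Γ, 𝒥, w, hw⟩ := hreach (K₀ ⊓ Ksm) Dμ φ hKK inf_le_right hφ
  obtain ⟨M, iFM, iNM, iCM, e, ιB, θB, hB⟩ := hCM F hG h6 Φ ι₁ hι V Dμ
  exact ⟨Γ, 𝒥, exists_hom_cmAV_ne_zero_of_isInverse_reflex h₃ F ι₁ (hμ F hG h6 Φ ι₁ hι V) e hB hw⟩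

/-- **(S2-∃) at a pinned datum, `hirr` re-typed** — the supply clause of item (vi) in the ∃ι₁ ∃V ∃Γ form the day-1 assembly consumes
(§1 ∘ item6-p1's `exists_supplyWitness_of_faceSupply`).  HC_CM is NOT proved.
[cite: Liu2021, Thm. 4.18 (FJcycle.tex l. 2232–2245), Def. 4.11 (l. 2083–2097), App. D Lem. D.1 (1) (l. 5226–5229)] -/
theorem exists_supplyWitness_of_thm418AsPrinted_pinned_def411
    (hHD : exists_isReal_hodgeModel) (hI : hodgePQ_independent_of_hodgeModel)
    (h₁ : BallQuotientUniformised) (h₃ : CMAbelianVarietyRealised)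
    (D : ∀ (F : CMField) (ι₁ : F →+* ℂ) (_ : HermSpace3 F ι₁) (_ : CMType F), Thm418Data (maximalRealSubfield F) F)
    (Aμ : ∀ (F : CMField) (ι₁ : F →+* ℂ) (V : HermSpace3 F ι₁) (Φ : CMType F), (D F ι₁ V Φ).Obj → AbelianVariety ℂ)
    (hLiu : ∀ (F : CMField), IsGalois ℚ F → 6 ≤ Module.finrank ℚ F → ∀ (Φ : CMType F) (ι₁ : F →+* ℂ), ι₁ ∈ Φ.1 →
      ∀ V : HermSpace3 F ι₁, Thm418AsPrinted (D F ι₁ V Φ))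
    (hObj : ∀ (F : CMField), IsGalois ℚ F → 6 ≤ Module.finrank ℚ F → ∀ (Φ : CMType F) (ι₁ : F →+* ℂ), ι₁ ∈ Φ.1 →
      ∀ V : HermSpace3 F ι₁, Nonempty (D F ι₁ V Φ).Obj)
    (h411 : ∀ (F : CMField), IsGalois ℚ F → 6 ≤ Module.finrank ℚ F → ∀ (Φ : CMType F) (ι₁ : F →+* ℂ), ι₁ ∈ Φ.1 →
      ∀ V : HermSpace3 F ι₁, Def411AsPrinted (D F ι₁ V Φ))
    (hnv : ∀ (F : CMField), IsGalois ℚ F → 6 ≤ Module.finrank ℚ F → ∀ (Φ : CMType F) (ι₁ : F →+* ℂ), ι₁ ∈ Φ.1 →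
      ∀ V : HermSpace3 F ι₁, ∃ i : (D F ι₁ V Φ).AdmIndex, Nontrivial ((D F ι₁ V Φ).omegaAt i))
    (hμ : ∀ (F : CMField), IsGalois ℚ F → 6 ≤ Module.finrank ℚ F → ∀ (Φ : CMType F) (ι₁ : F →+* ℂ), ι₁ ∈ Φ.1 →
      ∀ (V : HermSpace3 F ι₁) (g : F ≃ₐ[ℚ] F),
        ι₁.comp (g : F →+* F) ∈ (D F ι₁ V Φ).cmType.1 ↔ ι₁.comp (g.symm : F →+* F) ∈ Φ.1)
    (hCM : ∀ (F : CMField) (_ : IsGalois ℚ F), 6 ≤ Module.finrank ℚ F → ∀ (Φ : CMType F) (ι₁ : F →+* ℂ), ι₁ ∈ Φ.1 →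
      ∀ (V : HermSpace3 F ι₁) (Dμ : (D F ι₁ V Φ).Obj),
        ∃ (M : Type) (_ : Field M) (_ : NumberField M) (_ : IsCMField M)
          (e : reflexField ℚ F (algValuedIn ι₁ (D F ι₁ V Φ).cmType.1) →+* M)
          (ιB : 𝓞 M →+* End (Aμ F ι₁ V Φ Dμ)) (θB : M →+* Module.End ℂ (complexBetti (Aμ F ι₁ V Φ Dμ).X 1)),
          IsCMTypeRealisation (inducedCMType e (reflexCMType ι₁ (D F ι₁ V Φ).cmType (AlgHom.id ℚ F))) (Aμ F ι₁ V Φ Dμ) ιB θB)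
    (hReach : ∀ (F : CMField), IsGalois ℚ F → 6 ≤ Module.finrank ℚ F → ∀ (Φ : CMType F) (ι₁ : F →+* ℂ), ι₁ ∈ Φ.1 →
      ∀ V : HermSpace3 F ι₁, ∃ Ksm : Subgroup (D F ι₁ V Φ).G, IsOpenCompact Ksm ∧
        ∀ (K : Subgroup (D F ι₁ V Φ).G) (Dμ : (D F ι₁ V Φ).Obj) (φ : (D F ι₁ V Φ).HomK K Dμ),
          IsOpenCompact K → K ≤ Ksm → φ ≠ 0 →
            ∃ (Γ : Level V) (𝒥 : Jacobian (Var.scheme (ballQuotientUniformisedDatum_of h₁) h₃ (.pms (pmsCode F ι₁ V Γ))))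
              (w : 𝒥.J ⟶ Aμ F ι₁ V Φ Dμ), w ≠ 0) :
    ∀ (F : CMField), IsGalois ℚ F → 6 ≤ Module.finrank ℚ F → ∀ f : Face F,
      ∃ ι₁ : F →+* ℂ, f.Admissible ι₁ ∧ ∃ (V : HermSpace3 F ι₁) (Γ : Level V)
        (ω₀ ω₁ : (picardCMUniverse hHD hI h₁ h₃).CohC ((picardCMUniverse hHD hI h₁ h₃).pms F ι₁ V Γ) 1),
        ω₀ ∈ (picardCMUniverse hHD hI h₁ h₃).Uiso Γ F (f.psi 0) ι₁ ∧
          ω₁ ∈ (picardCMUniverse hHD hI h₁ h₃).Uiso Γ F (f.psi 1) ι₁ ∧ ω₀ ≠ 0 ∧ ω₁ ≠ 0 :=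
  exists_supplyWitness_of_faceSupply hHD hI h₁ h₃
    (faceSupply_of_thm418AsPrinted_pinned_def411 hHD hI h₁ h₃ D Aμ hLiu hObj h411 hnv hμ hCM hReach)

end Data

/-! ## §2  (β)-FREE END DISPLAYS on the universe of record, in the consumed form (g) (repair R2) -/

section EndState

/-- **END DISPLAY at a pinned datum, MEETING FORM — p297535's eight binders VERBATIM, `hD` ↦ `hM`** (`let U := U_rec`,
`let hU := ballQuotientUniformisedDatum_of ballQuotientUniformised_holds` for legibility).  `HC_CM` from [Liu 2021, Thm. 4.18] AS
PRINTED (`hLiu`), `hObj`, `hChi`, `hirr`/`hsm` (TAG CORRECTED per D6.3: [Liu2021] Def. 4.11 l. 2096 ‹irreducible admissible› + App. D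
Lem. D.1 (1) l. 5226–5229 at n = 3 — the Mathlib `IsIrreducible` carries `ω ≠ 0`; the as-printed shape is §1's `h411` + `hnv`), the
CHOICE `hμ`, the PIN `Aμ` with `hCM` and `hReach` — and the THETA-SIDE MEETING BINDER `hM` over the model's own `Model.embOf`
(VERBATIM the second hypothesis of x2's `hc_cm_of_supply_of_settingMeetSat_embOf_rec`, `CorCM/B01/FaceWedgeOverlapBypassMeeting.lean`
:297, p295997: isolation setting `S` over `L²([U(V)], autMeasure V)`, C5′ at the saturated (12)-sets, C6′ — its residual (E)/(v-S)/C6′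
is that file's header).  Versus `Model.hc_cm_of_thm418AsPrinted_pinned` (p297535): NO `HG`/`emb`/`cover` data, NO clause (α)/(β)/(γ)
— clause (β) `emb_cover`, ruled STRONGER-THAN-CONSUMED (tgtbt-1, STATUS-2100 §6 (i)), is GONE; item (iii) is inside x2's display as
the tree theorems `Model.embOf_inner_emb` / `Model.embOf_ne_zero_of_two_lt`.  Composition BY NAME:
`hc_cm_of_supply_of_settingMeetSat_embOf_rec` ∘ `faceSupply_of_thm418AsPrinted_pinned`.  HC_CM is NOT proved: `hCM`, `hReach`, `hM`
are inhabited by no one, and the pin adds no kernel content toward S2 (`Item6SupplyPinnedCertificate.lean`).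
[cite: Liu2021, Thm. 4.18 (FJcycle.tex l. 2232–2245)] -/
theorem hc_cm_of_thm418AsPrinted_pinned_meeting_rec :
    let U := picardCMUniverse exists_isReal_hodgeModel_holds hodgePQ_independent_of_hodgeModel_holds
      BallQuotient.ballQuotientUniformised_holds cmAbelianVarietyRealised_holds
    let hU := ballQuotientUniformisedDatum_of BallQuotient.ballQuotientUniformised_holds
    ∀
    (D : ∀ (F : CMField) (ι₁ : F →+* ℂ) (_ : HermSpace3 F ι₁) (_ : CMType F), Thm418Data (maximalRealSubfield F) F)
    (Aμ : ∀ (F : CMField) (ι₁ : F →+* ℂ) (V : HermSpace3 F ι₁) (Φ : CMType F), (D F ι₁ V Φ).Obj → AbelianVariety ℂ)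
    (hLiu : ∀ (F : CMField), IsGalois ℚ F → 6 ≤ Module.finrank ℚ F → ∀ (Φ : CMType F) (ι₁ : F →+* ℂ), ι₁ ∈ Φ.1 →
      ∀ V : HermSpace3 F ι₁, Thm418AsPrinted (D F ι₁ V Φ))
    (hObj : ∀ (F : CMField), IsGalois ℚ F → 6 ≤ Module.finrank ℚ F → ∀ (Φ : CMType F) (ι₁ : F →+* ℂ), ι₁ ∈ Φ.1 →
      ∀ V : HermSpace3 F ι₁, Nonempty (D F ι₁ V Φ).Obj)
    (hChi : ∀ (F : CMField), IsGalois ℚ F → 6 ≤ Module.finrank ℚ F → ∀ (Φ : CMType F) (ι₁ : F →+* ℂ), ι₁ ∈ Φ.1 →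
      ∀ V : HermSpace3 F ι₁, Nonempty (D F ι₁ V Φ).Chi)
    (hirr : ∀ (F : CMField), IsGalois ℚ F → 6 ≤ Module.finrank ℚ F → ∀ (Φ : CMType F) (ι₁ : F →+* ℂ), ι₁ ∈ Φ.1 →
      ∀ (V : HermSpace3 F ι₁) (i : (D F ι₁ V Φ).AdmIndex), ((D F ι₁ V Φ).rhoAt i).IsIrreducible)
    (hsm : ∀ (F : CMField), IsGalois ℚ F → 6 ≤ Module.finrank ℚ F → ∀ (Φ : CMType F) (ι₁ : F →+* ℂ), ι₁ ∈ Φ.1 →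
      ∀ (V : HermSpace3 F ι₁) (i : (D F ι₁ V Φ).AdmIndex) (v : (D F ι₁ V Φ).omegaAt i),
        ∃ S : Subgroup (D F ι₁ V Φ).G, IsOpen (S : Set (D F ι₁ V Φ).G) ∧ ∀ k ∈ S, (D F ι₁ V Φ).rhoAt i k v = v)
    (hμ : ∀ (F : CMField), IsGalois ℚ F → 6 ≤ Module.finrank ℚ F → ∀ (Φ : CMType F) (ι₁ : F →+* ℂ), ι₁ ∈ Φ.1 →
      ∀ (V : HermSpace3 F ι₁) (g : F ≃ₐ[ℚ] F),
        ι₁.comp (g : F →+* F) ∈ (D F ι₁ V Φ).cmType.1 ↔ ι₁.comp (g.symm : F →+* F) ∈ Φ.1)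
    (hCM : ∀ (F : CMField) [IsGalois ℚ F], 6 ≤ Module.finrank ℚ F → ∀ (Φ : CMType F) (ι₁ : F →+* ℂ), ι₁ ∈ Φ.1 →
      ∀ (V : HermSpace3 F ι₁) (Dμ : (D F ι₁ V Φ).Obj),
        ∃ (M : Type) (_ : Field M) (_ : NumberField M) (_ : IsCMField M)
          (e : reflexField ℚ F (algValuedIn ι₁ (D F ι₁ V Φ).cmType.1) →+* M)
          (ιB : 𝓞 M →+* End (Aμ F ι₁ V Φ Dμ)) (θB : M →+* Module.End ℂ (complexBetti (Aμ F ι₁ V Φ Dμ).X 1)),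
          IsCMTypeRealisation (inducedCMType e (reflexCMType ι₁ (D F ι₁ V Φ).cmType (AlgHom.id ℚ F))) (Aμ F ι₁ V Φ Dμ) ιB θB)
    (hReach : ∀ (F : CMField), IsGalois ℚ F → 6 ≤ Module.finrank ℚ F → ∀ (Φ : CMType F) (ι₁ : F →+* ℂ), ι₁ ∈ Φ.1 →
      ∀ V : HermSpace3 F ι₁, ∃ Ksm : Subgroup (D F ι₁ V Φ).G, IsOpenCompact Ksm ∧
        ∀ (K : Subgroup (D F ι₁ V Φ).G) (Dμ : (D F ι₁ V Φ).Obj) (φ : (D F ι₁ V Φ).HomK K Dμ),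
          IsOpenCompact K → K ≤ Ksm → φ ≠ 0 →
            ∃ (Γ : Level V) (𝒥 : Jacobian (Var.scheme hU cmAbelianVarietyRealised_holds (.pms (pmsCode F ι₁ V Γ))))
              (w : 𝒥.J ⟶ Aμ F ι₁ V Φ Dμ), w ≠ 0)
    (hM : ∀ (F : CMField), IsGalois ℚ F → 6 ≤ Module.finrank ℚ F → ∀ (f : Face F) (ι₁ : F →+* ℂ), f.Admissible ι₁ →
      ∀ V : HermSpace3 F ι₁,
      ∃ (H CG G SK SigIdx SigIdxG : Type) (_ : NormedAddCommGroup H) (_ : InnerProductSpace ℂ H) (_ : CompleteSpace H)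
        (_ : NormedAddCommGroup CG) (_ : NormedSpace ℂ CG) (_ : Group G) (_ : TopologicalSpace G) (_ : TopologicalSpace SK)
        (S : Perl34.IsolationSetting H (Lp ℂ 2 V.autMeasure) CG G SK SigIdx SigIdxG),
        (∀ (Γ : Level V) (ω₁ ω₂ : U.CohC (U.pms F ι₁ V Γ) 1),
          ω₁ ∈ U.Uiso Γ F (f.psi 0) ι₁ → ω₂ ∈ U.Uiso Γ F (f.psi 1) ι₁ →
            embOf exists_isReal_hodgeModel_holds hodgePQ_independent_of_hodgeModel_holds hU cmAbelianVarietyRealised_holds Γ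
                (U.cup2C (U.pms F ι₁ V Γ) 1 ω₁ ω₂) ≠ 0 →
              ∃ u ∈ S.t12.S12,
                ⟪embOf exists_isReal_hodgeModel_holds hodgePQ_independent_of_hodgeModel_holds hU cmAbelianVarietyRealised_holds Γ
                    (U.cup2C (U.pms F ι₁ V Γ) 1 ω₁ ω₂), u⟫_ℂ ≠ 0) ∧
        (∀ χ : S.t34.X, S.t34.allowed χ → ∀ (Φ : SK) (Γ₁ : Level V)
          (ω₁ ω₂ : U.CohC (U.pms F ι₁ V Γ₁) 1),
          ω₁ ∈ U.Uiso Γ₁ F (f.psi 0) ι₁ →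
          ω₂ ∈ U.Uiso Γ₁ F (f.psi 1) ι₁ →
            ⟪embOf exists_isReal_hodgeModel_holds hodgePQ_independent_of_hodgeModel_holds hU cmAbelianVarietyRealised_holds Γ₁
                (U.cup2C (U.pms F ι₁ V Γ₁) 1 ω₁ ω₂),
              S.t34.ϑ χ Φ⟫_ℂ ≠ 0 →
              ∃ (Γ : Level V) (ω : Fin 4 → U.CohC (U.pms F ι₁ V Γ) 1),
                (∀ i, ω i ∈ U.Uiso Γ F (f.psi i) ι₁) ∧
                  ⟪embOf exists_isReal_hodgeModel_holds hodgePQ_independent_of_hodgeModel_holds hU cmAbelianVarietyRealised_holds Γ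
                      (U.cup2C (U.pms F ι₁ V Γ) 1 (ω 2) (ω 3)),
                    embOf exists_isReal_hodgeModel_holds hodgePQ_independent_of_hodgeModel_holds hU cmAbelianVarietyRealised_holds Γ
                      (U.cup2C (U.pms F ι₁ V Γ) 1 (ω 0) (ω 1))⟫_ℂ
                    ≠ 0)),
    HC_CM := by
  intro U hU D Aμ hLiu hObj hChi hirr hsm hμ hCM hReach hM
  exact hc_cm_of_supply_of_settingMeetSat_embOf_rec
    (faceSupply_of_thm418AsPrinted_pinned _ _ _ _ D Aμ hLiu hObj hChi hirr hsm hμ hCM hReach) hM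

/-- **END DISPLAY at a pinned datum, RE-TYPED (R1 + R2)**: `HC_CM` on the universe OF RECORD from §1's binders — `hLiu` ([Liu2021]
Thm. 4.18 AS PRINTED), `hObj` (Prop. 4.6 (1)), `h411` (Def. 4.11 AS PRINTED, the record), `hnv` (App. D Lem. D.1 (1) at n = 3 with
Def. 4.12), the CHOICE `hμ`, the PIN `Aμ` with `hCM` (Def. 4.5 (2)/4.3 (2) at the dictionary) and `hReach` (§4.2 + Prop. C.5 with
(h2)–(h4) = the S2-CRUX (M-Sh)) — and x2's theta-side meeting binder `hM` over `Model.embOf` (no `hD`, no `cover`, no (β)).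
Composition BY NAME: `hc_cm_of_supply_of_settingMeetSat_embOf_rec` ∘ `faceSupply_of_thm418AsPrinted_pinned_def411`.  HC_CM is NOT
proved: `hCM`, `hReach`, `hM` are inhabited by no one.
[cite: Liu2021, Thm. 4.18 (FJcycle.tex l. 2232–2245), Def. 4.11 (l. 2083–2097), App. D Lem. D.1 (1) (l. 5226–5229)] -/
theorem hc_cm_of_thm418AsPrinted_pinned_def411_meeting_rec :
    let U := picardCMUniverse exists_isReal_hodgeModel_holds hodgePQ_independent_of_hodgeModel_holds
      BallQuotient.ballQuotientUniformised_holds cmAbelianVarietyRealised_holds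
    let hU := ballQuotientUniformisedDatum_of BallQuotient.ballQuotientUniformised_holds
    ∀
    (D : ∀ (F : CMField) (ι₁ : F →+* ℂ) (_ : HermSpace3 F ι₁) (_ : CMType F), Thm418Data (maximalRealSubfield F) F)
    (Aμ : ∀ (F : CMField) (ι₁ : F →+* ℂ) (V : HermSpace3 F ι₁) (Φ : CMType F), (D F ι₁ V Φ).Obj → AbelianVariety ℂ)
    (hLiu : ∀ (F : CMField), IsGalois ℚ F → 6 ≤ Module.finrank ℚ F → ∀ (Φ : CMType F) (ι₁ : F →+* ℂ), ι₁ ∈ Φ.1 →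
      ∀ V : HermSpace3 F ι₁, Thm418AsPrinted (D F ι₁ V Φ))
    (hObj : ∀ (F : CMField), IsGalois ℚ F → 6 ≤ Module.finrank ℚ F → ∀ (Φ : CMType F) (ι₁ : F →+* ℂ), ι₁ ∈ Φ.1 →
      ∀ V : HermSpace3 F ι₁, Nonempty (D F ι₁ V Φ).Obj)
    (h411 : ∀ (F : CMField), IsGalois ℚ F → 6 ≤ Module.finrank ℚ F → ∀ (Φ : CMType F) (ι₁ : F →+* ℂ), ι₁ ∈ Φ.1 →
      ∀ V : HermSpace3 F ι₁, Def411AsPrinted (D F ι₁ V Φ))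
    (hnv : ∀ (F : CMField), IsGalois ℚ F → 6 ≤ Module.finrank ℚ F → ∀ (Φ : CMType F) (ι₁ : F →+* ℂ), ι₁ ∈ Φ.1 →
      ∀ V : HermSpace3 F ι₁, ∃ i : (D F ι₁ V Φ).AdmIndex, Nontrivial ((D F ι₁ V Φ).omegaAt i))
    (hμ : ∀ (F : CMField), IsGalois ℚ F → 6 ≤ Module.finrank ℚ F → ∀ (Φ : CMType F) (ι₁ : F →+* ℂ), ι₁ ∈ Φ.1 →
      ∀ (V : HermSpace3 F ι₁) (g : F ≃ₐ[ℚ] F),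
        ι₁.comp (g : F →+* F) ∈ (D F ι₁ V Φ).cmType.1 ↔ ι₁.comp (g.symm : F →+* F) ∈ Φ.1)
    (hCM : ∀ (F : CMField) (_ : IsGalois ℚ F), 6 ≤ Module.finrank ℚ F → ∀ (Φ : CMType F) (ι₁ : F →+* ℂ), ι₁ ∈ Φ.1 →
      ∀ (V : HermSpace3 F ι₁) (Dμ : (D F ι₁ V Φ).Obj),
        ∃ (M : Type) (_ : Field M) (_ : NumberField M) (_ : IsCMField M)
          (e : reflexField ℚ F (algValuedIn ι₁ (D F ι₁ V Φ).cmType.1) →+* M)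
          (ιB : 𝓞 M →+* End (Aμ F ι₁ V Φ Dμ)) (θB : M →+* Module.End ℂ (complexBetti (Aμ F ι₁ V Φ Dμ).X 1)),
          IsCMTypeRealisation (inducedCMType e (reflexCMType ι₁ (D F ι₁ V Φ).cmType (AlgHom.id ℚ F))) (Aμ F ι₁ V Φ Dμ) ιB θB)
    (hReach : ∀ (F : CMField), IsGalois ℚ F → 6 ≤ Module.finrank ℚ F → ∀ (Φ : CMType F) (ι₁ : F →+* ℂ), ι₁ ∈ Φ.1 →
      ∀ V : HermSpace3 F ι₁, ∃ Ksm : Subgroup (D F ι₁ V Φ).G, IsOpenCompact Ksm ∧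
        ∀ (K : Subgroup (D F ι₁ V Φ).G) (Dμ : (D F ι₁ V Φ).Obj) (φ : (D F ι₁ V Φ).HomK K Dμ),
          IsOpenCompact K → K ≤ Ksm → φ ≠ 0 →
            ∃ (Γ : Level V) (𝒥 : Jacobian (Var.scheme hU cmAbelianVarietyRealised_holds (.pms (pmsCode F ι₁ V Γ))))
              (w : 𝒥.J ⟶ Aμ F ι₁ V Φ Dμ), w ≠ 0)
    (hM : ∀ (F : CMField), IsGalois ℚ F → 6 ≤ Module.finrank ℚ F → ∀ (f : Face F) (ι₁ : F →+* ℂ), f.Admissible ι₁ →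
      ∀ V : HermSpace3 F ι₁,
      ∃ (H CG G SK SigIdx SigIdxG : Type) (_ : NormedAddCommGroup H) (_ : InnerProductSpace ℂ H) (_ : CompleteSpace H)
        (_ : NormedAddCommGroup CG) (_ : NormedSpace ℂ CG) (_ : Group G) (_ : TopologicalSpace G) (_ : TopologicalSpace SK)
        (S : Perl34.IsolationSetting H (Lp ℂ 2 V.autMeasure) CG G SK SigIdx SigIdxG),
        (∀ (Γ : Level V) (ω₁ ω₂ : U.CohC (U.pms F ι₁ V Γ) 1),
          ω₁ ∈ U.Uiso Γ F (f.psi 0) ι₁ → ω₂ ∈ U.Uiso Γ F (f.psi 1) ι₁ →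
            embOf exists_isReal_hodgeModel_holds hodgePQ_independent_of_hodgeModel_holds hU cmAbelianVarietyRealised_holds Γ
                (U.cup2C (U.pms F ι₁ V Γ) 1 ω₁ ω₂) ≠ 0 →
              ∃ u ∈ S.t12.S12,
                ⟪embOf exists_isReal_hodgeModel_holds hodgePQ_independent_of_hodgeModel_holds hU cmAbelianVarietyRealised_holds Γ
                    (U.cup2C (U.pms F ι₁ V Γ) 1 ω₁ ω₂), u⟫_ℂ ≠ 0) ∧
        (∀ χ : S.t34.X, S.t34.allowed χ → ∀ (Φ : SK) (Γ₁ : Level V)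
          (ω₁ ω₂ : U.CohC (U.pms F ι₁ V Γ₁) 1),
          ω₁ ∈ U.Uiso Γ₁ F (f.psi 0) ι₁ →
          ω₂ ∈ U.Uiso Γ₁ F (f.psi 1) ι₁ →
            ⟪embOf exists_isReal_hodgeModel_holds hodgePQ_independent_of_hodgeModel_holds hU cmAbelianVarietyRealised_holds Γ₁
                (U.cup2C (U.pms F ι₁ V Γ₁) 1 ω₁ ω₂),
              S.t34.ϑ χ Φ⟫_ℂ ≠ 0 →
              ∃ (Γ : Level V) (ω : Fin 4 → U.CohC (U.pms F ι₁ V Γ) 1),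
                (∀ i, ω i ∈ U.Uiso Γ F (f.psi i) ι₁) ∧
                  ⟪embOf exists_isReal_hodgeModel_holds hodgePQ_independent_of_hodgeModel_holds hU cmAbelianVarietyRealised_holds Γ
                      (U.cup2C (U.pms F ι₁ V Γ) 1 (ω 2) (ω 3)),
                    embOf exists_isReal_hodgeModel_holds hodgePQ_independent_of_hodgeModel_holds hU cmAbelianVarietyRealised_holds Γ
                      (U.cup2C (U.pms F ι₁ V Γ) 1 (ω 0) (ω 1))⟫_ℂ
                    ≠ 0)),
    HC_CM := by
  intro U hU D Aμ hLiu hObj h411 hnv hμ hCM hReach hM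
  exact hc_cm_of_supply_of_settingMeetSat_embOf_rec
    (faceSupply_of_thm418AsPrinted_pinned_def411 _ _ _ _ D Aμ hLiu hObj h411 hnv hμ hCM hReach) hM

end EndState

end Summit.HodgeConjecture.CorCM.Model

end
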